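import Mathlib.Topology.Algebra.OpenSubgroup
import Literature.AlgebraicGeometry.Frobenioids.KummerReciprocity
import HarnessLib

/-!
# Frobenioids II, §2: Definition 2.2 (i)–(iii), Remark 2.2.1, Theorem 2.4, Remark 2.4.2

Mochizuki, *The geometry of Frobenioids II*, Kyushu J. Math. **62** (2008) 401–460, §2 "The Kummer
and Reciprocity Maps", author's text pp. 17–22 [cite: MochizukiFrdII2008, Def 2.2 p.17].

**Setting (p. 17).** `C` a `p`-adic Frobenioid (Ex. 1.1 (ii)) with `Λ = ℤ` over
`D = B^temp(Π, Π°)⁰` (Ex. 1.3 (iii), `F = ℚ_p`, `G_{ℚ_p} ↠ Q` an isomorphism), `G := Im(Π) ⊆ Q`,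
`G° := Im(Π°)`, `E := B^temp(G, G°)⁰`, `K/ℚ_p` the finite extension determined by `G`, the natural
functor `D → E`; `H ⊆ G` a normal open subgroup, `N ∈ ℕ_{≥1}`, `A ∈ Ob(C)`, `A_D := Base(A)`,
`A_E` the projection of `A` to `E`.

**Granularity (honest framing).** The `p`-adic Frobenioid `C` (Ex. 1.1 (ii)), its base
`B^temp(Π, Π°)⁰` (Ex. 1.3) and "`A_D` is Galois" are abc-iut-L1-t4's files (in review); until they
are instantiated here, the objects Def. 2.2 names for ONE object `A` are the fields of the
STATEMENT-LEVEL INTERFACE `Def22Context` (TODO-merge abc-iut-L1-t4), each quoting the printed phrase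
it abbreviates. `Def22Context`, `GA`, `gaToAutE`, `ActionFactors`, `GaloisSurjective`, `HA`, `toHA`
and the Theorem 2.4 data follow abc-iut-L1-t4's draft p404617 (near-verbatim where adopted); here the
descended action of `Aut_E(A_E)` on `O^□(A)` and the continuity of `G ↠ Aut_E(A_E)` are fields, so
that Def. 2.2 (ii)(c) is stated on THE inflation maps along the continuous surjection `H ↠ H_A` in
continuous cohomology (`Kummer.infl`, `Kummer.IsCohSaturated`, `Kummer.FN`).

**Contents.** Def. 2.2 (i): `G_A := Aut_C(A)/Ker(Aut_C(A) → Aut_E(A_E))` (`GA`), the natural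
inclusion `G_A ↪ Aut_E(A_E)` (`gaToAutE`, injectivity PROVED), the printed claims "the conjugation
action factors through `G_A`" (`ActionFactors`, PROVED from the descended-action field) and "an
isomorphism if `A_D` is Galois" (`GaloisSurjective`), `H_A := Im(H)` (`HA`) with the continuous
surjection `H ↠ H_A` (`qHA`, surjectivity and continuity PROVED); (ii) `(N,H)`-saturated
(`IsNHSaturated` = (a) `Kummer.IsMuSaturated` ∧ (b) Galois ∧ (c) `Kummer.IsCohSaturated`), its
independence of the representative of the outer homomorphism (`SaturationConjugationInvariant`,
over `Def22Context.conjOuter`) and `F_N(A)` (`FN`); (iii) `O^□` (`OBox`); Remark 2.2.1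
(`ExistsSaturatedPullback`); Theorem 2.4 (i), (ii) (`Thm24Data`, `Thm24i`, `Thm24iExistsData`,
`Thm24ii`) and Remark 2.4.2 (`InvariantIncompatible`, `ActsOnFNByPower`) as `Prop`-valued statements
over two contexts with the comparison isomorphisms induced by `Ψ` as data.

Deliberately NOT here: (1) the clause of Theorem 2.4 (i) "as well as with the various natural
actions of `(G₁)_{A₁}/(H₁)_{A₁}`, `(G₂)_{A₂}/(H₂)_{A₂}`" — it needs the conjugation action of `G_A`
on `H¹(H_A, μ_N(A))` and on `F_N(A)` (functoriality of group cohomology in the pair (conjugation,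
action), not yet assembled over `KummerReciprocity.lean`); `Thm24i` states the Kummer and
reciprocity compatibilities only and says so; (2) Remark 2.4.1 (the PROFINITE version of
Theorem 2.4 (i) up to `(Gᵢ)_{Aᵢ}/(Hᵢ)_{Aᵢ}`-indeterminacy): it needs the inverse system over `N` of
the Kummer and reciprocity maps with varying `Aᵢ` and coefficients `μ_N(Aᵢ)` (p. 22), not typed in
this file (named deferral; the node stays open). Nothing here is asserted; the
local-class-field-theory inputs (the
cup-product duality isomorphism, `F_N(A) ≅ ℤ/Nℤ`) are explicit data (`Kummer.DualityIso`, `FNInvariant`;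
FOUNDATIONS row 15) — in the tree they are abc-iut-L4-t4's named facts
`Literature.AnabelianGeometry.AbsoluteAnabelian.mlf_H2_mu_equiv_zmod` (`H²(G_K, μ_n) ≃+ ℤ/nℤ` in
continuous cohomology) and `mlf_H1_mu_equiv_abelianization_mod` (the cup-product form
`H¹(G_K, μ_n) ≅ G_K^ab ⊗ H²(G_K, μ_n)`) of `LocalClassFieldTheoryForms.lean`, to be applied to the
fixed field of the open subgroup `H` when `Def22Context` is instantiated from the `p`-adic Frobenioid
(TODO-merge). Universe `0` as in `KummerClass.lean`.
-/

namespace Literature.AlgebraicGeometry.Frobenioids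

open groupCohomology
open scoped TensorProduct

namespace PadicKummer

/-- A group homomorphism with open kernel into any topological group with continuous multiplication
is continuous (used for `G ↠ Aut_E(A_E)`, whose kernel is the open subgroup of `A_E`).
[cite: MochizukiFrdII2008, Def 2.2 (i) p.17] -/
private theorem continuous_of_isOpen_ker {G H : Type*} [Group G] [TopologicalSpace G]
    [IsTopologicalGroup G] [Group H] [TopologicalSpace H] [ContinuousMul H] (f : G →* H)
    (hf : IsOpen (f.ker : Set G)) : Continuous f := by
  refine continuous_of_continuousAt_one f ?_
  rw [ContinuousAt, map_one]
  refine fun U hU => Filter.mem_map.mpr (Filter.mem_of_superset (hf.mem_nhds (by simp)) ?_)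
  intro g hg
  rw [SetLike.mem_coe, MonoidHom.mem_ker] at hg
  rw [Set.mem_preimage, hg]
  exact mem_of_mem_nhds hU

/-! ### Definition 2.2: the context of one object `A` (p. 17) -/

/-- **Definition 2.2, setting** (FrdII p. 17), for one object `A` of a `p`-adic Frobenioid `C`
(`Λ = ℤ`) over `D = B^temp(Π, Π°)⁰ → E = B^temp(G, G°)⁰`: the printed groups and actions, as an
interface (TODO-merge abc-iut-L1-t4 `PadicFrobenioid.lean` / `QuasiTemperoid.lean`).
* `AutC` = `Aut_C(A)`; `O` = the commutative monoid `O^□(A)` (`O^⊳(A)` or `O^×(A)`, Def. 2.2 (iii);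
  commutative by [FrdI] Rmk 1.3.1, cancellative) with "the natural action by conjugation of
  `Aut_C(A)`";
* `AutE` = `Aut_E(A_E)` with `res : Aut_C(A) → Aut_E(A_E)` "induced by the functor `C → E`", and the
  descended action of `Aut_E(A_E) ⊇ G_A` on `O^□(A)` ("the natural action … factors through the
  quotient `Aut_C(A) ↠ G_A`", Def. 2.2 (i), and `G_A ⥲ Aut_E(A_E)` for `A_D` Galois);
* `G` = `Im(Π) ⊆ Q ≅ G_{ℚ_p}` (a topological group), `H ⊆ G` "a normal open subgroup";
* `isGalois` = "`A_D` is Galois"; `outer : G → Aut_E(A_E)` a representative of "the natural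
  surjective outer homomorphism `G ↠ Aut_E(A_E)`" (available when `A_D` is Galois), with open kernel
  (it is `G ↠ G/U` for the open subgroup `U` classifying `A_E`).
In the intended model `Aut_E(A_E) = Aut(L/K)` acts on `O_L ⊇ O^□(A)`, so `actE` is available for
every `A`; for non-Galois `A_D` the field `outer` is a placeholder (any open-kernel homomorphism,
e.g. the trivial one, with `outer_surjective` vacuous) — the printed constructions that use it,
(ii) and Def. 2.3, all assume `A_D` Galois. [cite: MochizukiFrdII2008, Def 2.2 (i) p.17] -/
structure Def22Context : Type 1 where
  /-- `Aut_C(A)` -/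
  AutC : Type
  [grpAutC : Group AutC]
  /-- `O^□(A)` -/
  O : Type
  [monO : CommMonoid O]
  [cancelO : IsCancelMul O]
  /-- the conjugation action of `Aut_C(A)` on `O^□(A)` -/
  [actC : MulDistribMulAction AutC O]
  /-- `Aut_E(A_E)` -/
  AutE : Type
  [grpAutE : Group AutE]
  /-- the descended action of `Aut_E(A_E)` on `O^□(A)` -/
  [actE : MulDistribMulAction AutE O]
  /-- `Aut_C(A) → Aut_E(A_E)`, induced by `C → D → E` -/
  res : AutC →* AutE
  /-- the action of `Aut_C(A)` is the descended action through `res` -/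
  res_smul : ∀ (α : AutC) (x : O), res α • x = α • x
  /-- `G = Im(Π) ⊆ Q` -/
  G : Type
  [grpG : Group G]
  [topG : TopologicalSpace G]
  [topGrpG : IsTopologicalGroup G]
  /-- `H ⊆ G`, a normal open subgroup -/
  H : Subgroup G
  [normalH : H.Normal]
  isOpen_H : IsOpen (H : Set G)
  /-- "`A_D` is Galois" -/
  isGalois : Prop
  /-- a representative `G → Aut_E(A_E)` of the natural surjective outer homomorphism -/
  outer : G →* AutE
  outer_surjective : isGalois → Function.Surjective outer
  isOpen_ker_outer : IsOpen (outer.ker : Set G)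

attribute [instance] Def22Context.grpAutC Def22Context.monO Def22Context.cancelO
  Def22Context.actC Def22Context.grpAutE Def22Context.actE Def22Context.grpG Def22Context.topG
  Def22Context.topGrpG Def22Context.normalH

namespace Def22Context

variable (X : Def22Context)

/-- `Aut_E(A_E)` is finite in print; we give it the discrete topology.
[cite: MochizukiFrdII2008, Def 2.2 (i) p.17] -/
instance instTopologicalSpaceAutE : TopologicalSpace X.AutE := ⊥

/-- The topology on `Aut_E(A_E)` is discrete. [cite: MochizukiFrdII2008, Def 2.2 (i) p.17] -/
instance instDiscreteTopologyAutE : DiscreteTopology X.AutE := ⟨rfl⟩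

/-- **Definition 2.2 (i)** (FrdII p. 17): `G_A := Aut_C(A)/Ker(Aut_C(A) → Aut_E(A_E))`.
[cite: MochizukiFrdII2008, Def 2.2 (i) p.17] -/
abbrev GA : Type := X.AutC ⧸ X.res.ker

/-- **Definition 2.2 (i)** (FrdII p. 17): "the functor `C → E` induces a natural inclusion
`G_A ↪ Aut_E(A_E)`". [cite: MochizukiFrdII2008, Def 2.2 (i) p.17] -/
noncomputable def gaToAutE : X.GA →* X.AutE := QuotientGroup.kerLift X.res

/-- `G_A ↪ Aut_E(A_E)` is injective. [cite: MochizukiFrdII2008, Def 2.2 (i) p.17] -/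
theorem gaToAutE_injective : Function.Injective X.gaToAutE := QuotientGroup.kerLift_injective X.res

/-- **Definition 2.2 (i)**, claim (FrdII p. 17): "the natural action by conjugation of `Aut_C(A)` on
`O^×(A)` factors through the quotient `Aut_C(A) ↠ G_A`" — the kernel of `res` acts trivially.
[cite: MochizukiFrdII2008, Def 2.2 (i) p.17] -/
def ActionFactors : Prop := ∀ α : X.AutC, α ∈ X.res.ker → ∀ x : X.O, α • x = x

/-- The claim `ActionFactors` holds in the interface (the action IS descended along `res`); in the
`p`-adic Frobenioid it is [FrdII] Thm 1.2 (ii). [cite: MochizukiFrdII2008, Def 2.2 (i) p.17] -/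
theorem actionFactors : X.ActionFactors := fun α hα x => by
  rw [← X.res_smul, MonoidHom.mem_ker.mp hα, one_smul]

/-- **Definition 2.2 (i)**, claim (FrdII p. 17): the inclusion `G_A ↪ Aut_E(A_E)` "is an isomorphism
if, for instance, `A_D` is Galois [where we recall that `C` is `Aut`-ample — cf. Theorem 1.2, (i)]".
[cite: MochizukiFrdII2008, Def 2.2 (i) p.17] -/
def GaloisSurjective : Prop := X.isGalois → Function.Surjective X.gaToAutE

/-- **Definition 2.2 (i)** (FrdII p. 17): `H_A := Im(H) ⊆ G_A`, realised inside `Aut_E(A_E) ⊇ G_A` as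
the image of `H` under the representative `outer` of `G ↠ Aut_E(A_E) ⥲ G_A`; "well-defined, up to
composition with conjugation by an element of `G`" since `H` is normal in `G`.
[cite: MochizukiFrdII2008, Def 2.2 (i) p.17] -/
def HA : Subgroup X.AutE := X.H.map X.outer

/-- `H ↠ H_A := Im(H)`, the restriction of `outer` (FrdII Def. 2.2 (i), p. 17).
[cite: MochizukiFrdII2008, Def 2.2 (i) p.17] -/
noncomputable def toHA : X.H →* X.HA :=
  (X.outer.restrict X.H).codRestrict _ fun h => ⟨h, h.2, rfl⟩

/-- `H ↠ H_A` is surjective. [cite: MochizukiFrdII2008, Def 2.2 (i) p.17] -/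
theorem toHA_surjective : Function.Surjective X.toHA := fun ⟨_, h, hh, e⟩ => ⟨⟨h, hh⟩, Subtype.ext e⟩

/-- `H ↠ H_A` is continuous (`H ⊆ G` with the subspace topology, `H_A` discrete), since `outer` has
open kernel. [cite: MochizukiFrdII2008, Def 2.2 (i) p.17] -/
theorem continuous_toHA : Continuous X.toHA := by
  have hc : Continuous X.outer := continuous_of_isOpen_ker X.outer X.isOpen_ker_outer
  exact Continuous.subtype_mk (hc.comp continuous_subtype_val) _

/-- `H ↠ H_A` as a continuous homomorphism — the `q` of `KummerReciprocity.lean`.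
[cite: MochizukiFrdII2008, Def 2.2 (i) p.17] -/
noncomputable def qHA : X.H →ₜ* X.HA := ⟨X.toHA, X.continuous_toHA⟩

end Def22Context

/-! ### Definition 2.2 (ii): `(N, H)`-saturated objects; `F_N(A)` -/

section Saturated

variable (X : Def22Context) (N : ℕ)

/-- **Definition 2.2 (ii)** (FrdII p. 17): `A` is *`(N, H)`-saturated* if "(a) `A` is `μ_N`-saturated;
(b) `A_D` is Galois; (c) the natural surjective homomorphism `H ↠ H_A` induces isomorphisms on first
cohomology modules `H¹(H_A, μ_N(A)) ⥲ H¹(H, μ_N(A))`; `H¹(H_A, ℤ/Nℤ) ⥲ H¹(H, ℤ/Nℤ)` and a surjection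
on second cohomology modules `H²(H_A, μ_N(A)) ↠ H²(H, μ_N(A))`" — (a) is `Kummer.IsMuSaturated`
(Def. 2.1 (i)), (c) is `Kummer.IsCohSaturated` along `qHA` (continuous cohomology).
[cite: MochizukiFrdII2008, Def 2.2 (ii) p.17] -/
@[mk_iff] structure IsNHSaturated : Prop where
  /-- (a) `A` is `μ_N`-saturated -/
  muSaturated : Kummer.IsMuSaturated N X.O
  /-- (b) `A_D` is Galois -/
  galois : X.isGalois
  /-- (c) the cohomological condition on `H ↠ H_A` -/
  cohSaturated : Kummer.IsCohSaturated N X.O X.HA X.qHA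

/-- The context with the representative `outer` of the outer homomorphism `G ↠ Aut_E(A_E)`
replaced by its composite with conjugation by `outer g`, `g ∈ G` ("the homomorphism `G ↠ G_A` is
only determined up to composition with an inner automorphism", FrdII Def. 2.2 (i), p. 17); same
`G`, `H`, topology and kernel. [cite: MochizukiFrdII2008, Def 2.2 (i) p.17] -/
def _root_.Literature.AlgebraicGeometry.Frobenioids.PadicKummer.Def22Context.conjOuter
    (g : X.G) : Def22Context :=
  { X with
    outer := (MulAut.conj (X.outer g)).toMonoidHom.comp X.outer
    outer_surjective := fun h =>
      (MulAut.conj (X.outer g)).surjective.comp (X.outer_surjective h)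
    isOpen_ker_outer := by
      have : ((MulAut.conj (X.outer g)).toMonoidHom.comp X.outer).ker = X.outer.ker := by
        ext x
        simp only [MonoidHom.mem_ker, MonoidHom.coe_comp, Function.comp_apply,
          MulEquiv.coe_toMonoidHom]
        exact map_eq_one_iff _ (MulAut.conj (X.outer g)).injective
      rw [this]
      exact X.isOpen_ker_outer }

/-- "[conditions which are unaffected by composition with conjugation by an element of `G`]"
(FrdII Def. 2.2 (ii), p. 17): the saturation condition does not depend on the representative of
the outer homomorphism `G ↠ Aut_E(A_E) ⥲ G_A` — typed exactly as printed: invariance under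
replacing `outer` by its composite with conjugation by `outer g`, `g ∈ G` (`conjOuter`).
[cite: MochizukiFrdII2008, Def 2.2 (ii) p.17] -/
def SaturationConjugationInvariant : Prop :=
  ∀ g : X.G, IsNHSaturated X N ↔ IsNHSaturated (X.conjOuter g) N

/-- **Definition 2.2 (ii)** (FrdII pp. 17–18):
`F_N(A) := H²(H_A, μ_N(A))/Ker(H²(H_A, μ_N(A)) ↠ H²(H, μ_N(A)))` for the context `X`
(`Kummer.FN` along `qHA`); "so `F_N(A) ≅ H²(H, μ_N(A))`" is `Kummer.fnEquivOfSurjective`.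
[cite: MochizukiFrdII2008, Def 2.2 (ii) p.17] -/
abbrev FN : Type := Kummer.FN N X.O X.HA X.qHA

/-- "`F_N(A) ≅ H²(H, μ_N(A)) ≅ ℤ/Nℤ` [cf., e.g., [NSW], Chapter 7, Theorem 7.2.6]" (FrdII p. 18): "the
natural isomorphism `F_N(A) ⥲ ℤ/Nℤ`" of local class field theory (the invariant of the Brauer group
of the `p`-adic field `L^H`), as an explicit DATUM (LCFT boundary, FOUNDATIONS row 15; TODO-merge
abc-iut-L4-t4). Used in Theorem 2.4 (ii) and Remark 2.4.2. [cite: MochizukiFrdII2008, Def 2.2 (ii) p.18] -/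
structure FNInvariant : Type where
  /-- the natural isomorphism `F_N(A) ⥲ ℤ/Nℤ` -/
  toAddEquiv : FN X N ≃+ ZMod N

end Saturated

/-! ### Definition 2.2 (iii) and Remark 2.2.1 -/

/-- **Definition 2.2 (iii)** (FrdII p. 18): "`O^□(−) := O^⊳(−)` if `Φ` is fieldwise saturated [cf.
Example 1.1, (ii)], and `O^□(−) := O^×(−)` if `Φ` is not fieldwise saturated [e.g., if `Φ` is
absolutely primitive]" — as a submonoid of `O^⊳(A)` (`O^×(A)` = its units), depending on the
proposition "`Φ` is fieldwise saturated" (abc-iut-L1-t4's `PadicFrobenioid.lean`, TODO-merge).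
[cite: MochizukiFrdII2008, Def 2.2 (iii) p.18] -/
noncomputable def OBox (fieldwiseSaturated : Prop) (OTri : Type) [Monoid OTri] : Submonoid OTri :=
  by classical exact if fieldwiseSaturated then ⊤ else IsUnit.submonoid OTri

/-- **Remark 2.2.1** (FrdII p. 18): "it follows immediately from the definitions, together with the
finiteness of the cohomology modules `H¹(H, μ_N(A))`, `H²(H, μ_N(A))` [NSW, Thm 7.2.6], that given
an `A′ ∈ Ob(C)`, … for any `N`, `H` as in Definition 2.2, there exists a pull-back morphism `A″ → A′`
in `C` such that `A″` is `(N, H)`-saturated." Typed over the objects of `C`, the relation "there is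
a pull-back morphism `A″ → A′`" ([FrdI] Def. 1.2 (ii); abc-iut-found's `PreFrobenioid.IsPullbackMorphism`,
TODO-merge) and the family of contexts `A ↦ Def22Context` for the open normal subgroups `H ⊆ G`.
[cite: MochizukiFrdII2008, Rmk 2.2.1 p.18] -/
def ExistsSaturatedPullback (Obj OpenNormal : Type) (HasPullbackMorphismTo : Obj → Obj → Prop)
    (ctx : Obj → OpenNormal → Def22Context) : Prop :=
  ∀ (A' : Obj) (N : ℕ) (H : OpenNormal), 0 < N →
    ∃ A'' : Obj, HasPullbackMorphismTo A'' A' ∧ IsNHSaturated (ctx A'' H) N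

/-- **Remark 2.2.1, sequel** (FrdII p. 18): for `(N, H)`-saturated `A` with `A_E = Spec(L)`, "we have
a natural isomorphism `(O^□(A) ⊇) O^□(A)^H ⥲ O^□(L^H)`" and "any element `f ∈ O^□(A)^H` admits an
`N`-th root `g ∈ O^□(A)`" — the latter is `Kummer.InvariantsAdmitRoots`; recorded here as the
implication the remark draws from saturation (a property of the context, discharged for the `p`-adic
Frobenioid by Kummer theory of the field `L^H`). [cite: MochizukiFrdII2008, Rmk 2.2.1 p.18] -/
def SaturatedInvariantsAdmitRoots (X : Def22Context) (N : ℕ) : Prop :=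
  IsNHSaturated X N → Kummer.InvariantsAdmitRoots N X.O X.HA

/-! ### Theorem 2.4 and Remark 2.4.2 -/

section Thm24

variable (X₁ X₂ : Def22Context) (N : ℕ)

/-- **Theorem 2.4, data** (FrdII pp. 19–20). For `i = 1, 2`: `pᵢ`-adic Frobenioids `Cᵢ` (`Λ = ℤ`)
over `Dᵢ = B^temp(Πᵢ, Πᵢ°)⁰` with `Πᵢ → G_{ℚ_{pᵢ}}` open homomorphisms of temp-slim tempered groups,
open normal `Hᵢ ⊆ Gᵢ`, and an equivalence `Ψ : C₁ ⥲ C₂`, "which … necessarily induces a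
1-compatible equivalence `Ψ_Base : D₁ ⥲ D₂`, hence an outer isomorphism `Π₁ ⥲ Π₂` … that lies over
an outer isomorphism `G₁ ⥲ G₂`", assumed to map `H₁` onto `H₂`; for `(N, Hᵢ)`-saturated `Aᵢ` with
`Ψ(A₁) = A₂`, the comparison isomorphisms Theorem 2.4 (i) says `Ψ` induces — recorded as DATA over
the two contexts (their construction from `Ψ` is the category-theoretic content, discharged with the
real `p`-adic Frobenioids): `O^□(A₁)^{H₁} ⥲ O^□(A₂)^{H₂}` (here on all of `O^□`, equivariantly),
`(H₁)_{A₁} ⥲ (H₂)_{A₂}`, `(G₁)_{A₁} ⥲ (G₂)_{A₂}`, `H¹((H₁)_{A₁}, μ_N(A₁)) ⥲ H¹((H₂)_{A₂}, μ_N(A₂))`,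
`F_N(A₁) ⥲ F_N(A₂)`. [cite: MochizukiFrdII2008, Thm 2.4 (i) p.19] -/
structure Thm24Data : Type where
  /-- the outer isomorphism of topological groups `G₁ ⥲ G₂` (a representative), mapping `H₁`
  onto `H₂` -/
  isoG : X₁.G ≃ₜ* X₂.G
  mapsH : X₁.H.map isoG.toMulEquiv.toMonoidHom = X₂.H
  /-- `O^□(A₁) ⥲ O^□(A₂)` induced by `Ψ` -/
  isoO : X₁.O ≃* X₂.O
  /-- `(H₁)_{A₁} ⥲ (H₂)_{A₂}` -/
  isoHA : X₁.HA ≃* X₂.HA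
  /-- `(G₁)_{A₁} ⥲ (G₂)_{A₂}` -/
  isoGA : X₁.GA ≃* X₂.GA
  /-- `isoO` is equivariant along `isoHA` -/
  equivariant : ∀ (h : X₁.HA) (x : X₁.O), isoO ((h : X₁.AutE) • x) = (isoHA h : X₂.AutE) • isoO x
  /-- `H¹((H₁)_{A₁}, μ_N(A₁)) ⥲ H¹((H₂)_{A₂}, μ_N(A₂))` -/
  isoH1 : H1 (Rep.ofMulDistribMulAction X₁.HA (Kummer.Mu N X₁.O)) ≃+
    H1 (Rep.ofMulDistribMulAction X₂.HA (Kummer.Mu N X₂.O))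
  /-- `F_N(A₁) ⥲ F_N(A₂)` -/
  isoFN : FN X₁ N ≃+ FN X₂ N

variable {X₁ X₂ N}

/-- The map `H_{A₁}^ab ⊗ F_N(A₁) → H_{A₂}^ab ⊗ F_N(A₂)` induced by the comparison data (on the
codomains of the reciprocity maps). [cite: MochizukiFrdII2008, Thm 2.4 (i) p.19] -/
noncomputable def Thm24Data.recTargetMap (T : Thm24Data X₁ X₂ N) :
    Kummer.RecTarget N X₁.O X₁.HA X₁.qHA →ₗ[ℤ] Kummer.RecTarget N X₂.O X₂.HA X₂.qHA :=
  TensorProduct.map (MonoidHom.toAdditive (Abelianization.map T.isoHA.toMonoidHom)).toIntLinearMap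
    T.isoFN.toAddMonoidHom.toIntLinearMap

variable (X₁ X₂ N)

/-- **Theorem 2.4 (i)** (Category-theoreticity of the Kummer and reciprocity maps, FrdII pp. 19–20):
"`Φ₁` is fieldwise saturated if and only if `Φ₂` is. Moreover, `p₁ = p₂`; `Ψ` maps
`(N, H₁)`-saturated objects to `(N, H₂)`-saturated objects and induces isomorphisms of
monoids/modules [`Thm24Data`] which are compatible with the respective Kummer and reciprocity maps
`O^□(Aᵢ)^{Hᵢ} → H¹((Hᵢ)_{Aᵢ}, μ_N(Aᵢ))`; `O^□(Aᵢ)^{Hᵢ} → (Hᵢ)^ab_{Aᵢ} ⊗ F_N(Aᵢ)` as well as with the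
various natural actions of `(G₁)_{A₁}/(H₁)_{A₁}`, `(G₂)_{A₂}/(H₂)_{A₂}`." Stated for the primes
`pᵢ`, the propositions "`Φᵢ` fieldwise saturated", the comparison data `T` and the duality
isomorphisms `ιᵢ` (p. 18); Kummer compatibility: `isoH1 (κ_f) = κ_{isoO f}`; reciprocity
compatibility: `(isoHA^ab ⊗ isoFN) ∘ ι₁ = ι₂ ∘ isoH1`. OMITTED from this rendering (see the module
header): the final clause "as well as with the various natural actions of `(Gᵢ)_{Aᵢ}/(Hᵢ)_{Aᵢ}`"
(the `G_A/H_A`-equivariance of `isoH1`, `isoFN` along `isoGA`), pending the conjugation action on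
`H¹(H_A, μ_N(A))` and `F_N(A)`; `isoGA` is carried as data for it.
[cite: MochizukiFrdII2008, Thm 2.4 (i) p.19] -/
def Thm24i (p₁ p₂ : ℕ) (fs₁ fs₂ : Prop) (T : Thm24Data X₁ X₂ N)
    (ι₁ : Kummer.DualityIso N X₁.O X₁.HA X₁.qHA) (ι₂ : Kummer.DualityIso N X₂.O X₂.HA X₂.qHA) : Prop :=
  (fs₁ ↔ fs₂) ∧ p₁ = p₂ ∧ (IsNHSaturated X₁ N → IsNHSaturated X₂ N) ∧
    (∀ (hO₁ : Kummer.NthRootsDifferByUnits N X₁.O) (hO₂ : Kummer.NthRootsDifferByUnits N X₂.O)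
        (f₁ : Kummer.kummerDomain N X₁.O X₁.HA) (f₂ : Kummer.kummerDomain N X₂.O X₂.HA),
        (f₂ : X₂.O) = T.isoO f₁ →
          T.isoH1 (Kummer.kummerClass hO₁ X₁.HA f₁) = Kummer.kummerClass hO₂ X₂.HA f₂) ∧
    (∀ c, T.recTargetMap (ι₁.toAddEquiv c) = ι₂.toAddEquiv (T.isoH1 c))

/-- **Theorem 2.4 (ii)** (FrdII p. 20): "If the `Φᵢ` are fieldwise saturated, then the isomorphism
`F_N(A₁) ⥲ F_N(A₂)` of (i) is compatible with the natural isomorphisms `F_N(Aᵢ) ⥲ ℤ/Nℤ` [cf., e.g.,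
[NSW], Chapter 7, Theorem 7.2.6]." [cite: MochizukiFrdII2008, Thm 2.4 (ii) p.20] -/
def Thm24ii (fs₁ fs₂ : Prop) (T : Thm24Data X₁ X₂ N) (inv₁ : FNInvariant X₁ N)
    (inv₂ : FNInvariant X₂ N) : Prop :=
  fs₁ → fs₂ → ∀ x : FN X₁ N, inv₂.toAddEquiv (T.isoFN x) = inv₁.toAddEquiv x

/-- **Theorem 2.4 (i)**, existence form for every `N` (FrdII pp. 19–20): for each `N ≥ 1` there
are comparison data satisfying `Thm24i`, for given families of duality isomorphisms. (Remark 2.4.1,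
the profinite version "allowing `N` to vary" with a `(Gᵢ)_{Aᵢ}/(Hᵢ)_{Aᵢ}`-indeterminacy, is NOT
this statement and is not typed in this file — see the module header.)
[cite: MochizukiFrdII2008, Thm 2.4 (i) p.19] -/
def Thm24iExistsData (p₁ p₂ : ℕ) (fs₁ fs₂ : Prop)
    (ι₁ : ∀ N, Kummer.DualityIso N X₁.O X₁.HA X₁.qHA)
    (ι₂ : ∀ N, Kummer.DualityIso N X₂.O X₂.HA X₂.qHA) : Prop :=
  ∀ N : ℕ, 0 < N → ∃ T : Thm24Data X₁ X₂ N, Thm24i X₁ X₂ N p₁ p₂ fs₁ fs₂ T (ι₁ N) (ι₂ N)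

/-- **Remark 2.4.2** (FrdII p. 22): "if the `Φᵢ` are not fieldwise saturated, then the natural
isomorphisms `F_N(Aᵢ) ⥲ ℤ/Nℤ` are not, in general, compatible with the isomorphism
`F_N(A₁) ⥲ F_N(A₂)` induced by `Ψ`" — the incompatibility predicate (negation of the conclusion of
Theorem 2.4 (ii) for the data `T`). [cite: MochizukiFrdII2008, Rmk 2.4.2 p.22] -/
def InvariantIncompatible (T : Thm24Data X₁ X₂ N) (inv₁ : FNInvariant X₁ N)
    (inv₂ : FNInvariant X₂ N) : Prop :=
  ∃ x : FN X₁ N, inv₂.toAddEquiv (T.isoFN x) ≠ inv₁.toAddEquiv x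

/-- **Remark 2.4.2, example** (FrdII p. 22): "when the `Φᵢ` are absolutely primitive, an example of
such a `Ψ` is provided by the unit-wise Frobenius functor of [FrdI], Proposition 2.9, (ii), which
acts on `F_N(Aᵢ)` [relative to the natural isomorphisms `F_N(Aᵢ) ⥲ ℤ/Nℤ`] by raising to the `ζ`-th
power" — the predicate "`T` acts on `F_N` as multiplication by `ζ`" (additive notation for
`ℤ/Nℤ`). [cite: MochizukiFrdII2008, Rmk 2.4.2 p.22] -/
def ActsOnFNByPower (T : Thm24Data X₁ X₂ N) (inv₁ : FNInvariant X₁ N) (inv₂ : FNInvariant X₂ N)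
    (ζ : ZMod N) : Prop :=
  ∀ x : FN X₁ N, inv₂.toAddEquiv (T.isoFN x) = ζ * inv₁.toAddEquiv x

end Thm24

end PadicKummer

end Literature.AlgebraicGeometry.Frobenioids
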